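import Summits.Schanuel.Schanuel.Theorems.ZilberEacCriticalFibresZero
import HarnessLib

/-!
# The coupled limit system at critical size: a one-variable reduction, II (local analysis)

Zilber's Exponential-Algebraic Closedness, case ladder (host summit Schanuel, cell `pub-schanuel`,
seat 2, gen 14).  Continuation of `ZilberEacCriticalFibresZero` (notation there:
`Eⱼ(t) = P + aⱼe^{K+t}`, `g = Re Φ`).  Near a point `t₀` with `E₀(t₀), E₁(t₀) ≠ 0` the local branch

  `Φ(t) = α(log(E₀(t)/E₀(t₀)) + log E₀(t₀)) + (1-α)(log(E₁(t)/E₁(t₀)) + log E₁(t₀)) - t`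

is holomorphic with `Φ'(t) = -P((1-α)E₀(t) + αE₁(t))/(E₀(t)E₁(t))` (`eventually_hasDerivAt_localPhi`,
`localPhi_deriv_eq`); the NON-DEGENERACY quantity `M(t) = (1-α)E₀(t) + αE₁(t)` is exactly the
Jacobian factor of the coupled system (`ZilberEacCriticalFibresExistence`: `det = eP(r₁E₀ + r₀E₁)`).

* **`exists_admissible_criticalFibres`**: a point with `E₀, E₁ ≠ 0`, `g = 0` AND `M ≠ 0` (if the zero
  of `g` found in part I has `M = 0`, then `M`, of the form `P + be^{K+t}` with `b ≠ 0`, has no other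
  zero within distance `π`; `Φ` is not locally constant (its derivative would force `M ≡ 0`), so by
  the OPEN MAPPING THEOREM (`AnalyticAt.eventually_constant_or_nhds_le_map_nhds`) the image of a
  small good neighbourhood contains `Φ(t₀) + iε/2`, whose preimage is a new zero of `g = Re Φ` with
  `M ≠ 0`).
* **`criticalFibres_localInverse`**: at such a point `Φ' ≠ 0`, so `Φ` has a local inverse `ψ`
  (Mathlib's `HasStrictDerivAt.localInverse`): `Φ(ψ(τ)) = τ` near `Φ(t₀)`, `ψ → t₀`.

The supply of non-degenerate limit solutions built on `ψ` is `ZilberEacCriticalFibresSupply`.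

HONEST FRAMING: lemmas toward explicit members of an OPEN cell (`ECCell 3 2`);
NOT Schanuel's conjecture; EAC ⇏ SC.
-/

noncomputable section

open Complex Filter Topology

set_option linter.dupNamespace false

namespace Summit.Schanuel.Schanuel.Theorems

section Local

/-- Real part of the local logarithm `log(z/z₀) + log z₀`. [folklore] -/
theorem re_log_div_add_log {z z₀ : ℂ} (hz : z ≠ 0) (hz₀ : z₀ ≠ 0) :
    (log (z / z₀) + log z₀).re = Real.log ‖z‖ := by
  rw [Complex.add_re, Complex.log_re, Complex.log_re, norm_div,
    Real.log_div (norm_ne_zero_iff.2 hz) (norm_ne_zero_iff.2 hz₀)]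
  ring

/-- The local logarithm exponentiates back. [folklore] -/
theorem exp_log_div_add_log {z z₀ : ℂ} (hz : z ≠ 0) (hz₀ : z₀ ≠ 0) :
    exp (log (z / z₀) + log z₀) = z := by
  rw [Complex.exp_add, Complex.exp_log (div_ne_zero hz hz₀), Complex.exp_log hz₀,
    div_mul_cancel₀ _ hz₀]

/-- `Re Φ = g` on the domain. [folklore] -/
theorem re_localPhi (E₀ E₁ : ℂ → ℂ) (α : ℝ) {t₀ t : ℂ} (h₀ : E₀ t₀ ≠ 0) (h₁ : E₁ t₀ ≠ 0)
    (ht₀ : E₀ t ≠ 0) (ht₁ : E₁ t ≠ 0) :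
    ((α : ℂ) * (log (E₀ t / E₀ t₀) + log (E₀ t₀)) +
        (1 - (α : ℂ)) * (log (E₁ t / E₁ t₀) + log (E₁ t₀)) - t).re =
      α * Real.log ‖E₀ t‖ + (1 - α) * Real.log ‖E₁ t‖ - t.re := by
  rw [show (1 - (α : ℂ)) = ((1 - α : ℝ) : ℂ) by push_cast; ring, Complex.sub_re, Complex.add_re,
    Complex.re_ofReal_mul, Complex.re_ofReal_mul, re_log_div_add_log ht₀ h₀,
    re_log_div_add_log ht₁ h₁]

/-- `Eⱼ(t) = P + aⱼe^{K+t}` has derivative `Eⱼ(t) - P`. [folklore] -/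
theorem hasDerivAt_affExp (P a K t : ℂ) :
    HasDerivAt (fun t : ℂ => P + a * exp (K + t)) ((P + a * exp (K + t)) - P) t := by
  have h : HasDerivAt (fun t : ℂ => K + t) 1 t := (hasDerivAt_id t).const_add K
  have := (h.cexp.const_mul a).const_add P
  rw [show (P + a * exp (K + t)) - P = a * (exp (K + t) * 1) by ring]
  exact this

/-- **The local branch `Φ` is holomorphic near `t₀`, with
`Φ'(t) = α(E₀(t)-P)/E₀(t) + (1-α)(E₁(t)-P)/E₁(t) - 1`.** [folklore] -/
theorem eventually_hasDerivAt_localPhi (E₀ E₁ : ℂ → ℂ) (P : ℂ) (α : ℝ) {t₀ : ℂ}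
    (hd₀ : ∀ t, HasDerivAt E₀ (E₀ t - P) t) (hd₁ : ∀ t, HasDerivAt E₁ (E₁ t - P) t)
    (h₀ : E₀ t₀ ≠ 0) (h₁ : E₁ t₀ ≠ 0) :
    ∀ᶠ t in 𝓝 t₀, E₀ t ≠ 0 ∧ E₁ t ≠ 0 ∧
      HasDerivAt (fun t => (α : ℂ) * (log (E₀ t / E₀ t₀) + log (E₀ t₀)) +
          (1 - (α : ℂ)) * (log (E₁ t / E₁ t₀) + log (E₁ t₀)) - t)
        ((α : ℂ) * ((E₀ t - P) / E₀ t) + (1 - (α : ℂ)) * ((E₁ t - P) / E₁ t) - 1) t := by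
  have hc₀ : ContinuousAt (fun t => E₀ t / E₀ t₀) t₀ := (hd₀ t₀).continuousAt.div_const _
  have hc₁ : ContinuousAt (fun t => E₁ t / E₁ t₀) t₀ := (hd₁ t₀).continuousAt.div_const _
  have hs₀ : ∀ᶠ t in 𝓝 t₀, E₀ t / E₀ t₀ ∈ slitPlane := by
    apply hc₀.eventually_mem
    rw [div_self h₀]
    exact isOpen_slitPlane.mem_nhds one_mem_slitPlane
  have hs₁ : ∀ᶠ t in 𝓝 t₀, E₁ t / E₁ t₀ ∈ slitPlane := by
    apply hc₁.eventually_mem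
    rw [div_self h₁]
    exact isOpen_slitPlane.mem_nhds one_mem_slitPlane
  have hne₀ : ∀ᶠ t in 𝓝 t₀, E₀ t ≠ 0 := (hd₀ t₀).continuousAt.eventually_ne h₀
  have hne₁ : ∀ᶠ t in 𝓝 t₀, E₁ t ≠ 0 := (hd₁ t₀).continuousAt.eventually_ne h₁
  filter_upwards [hs₀, hs₁, hne₀, hne₁] with t ht₀ ht₁ hn₀ hn₁
  refine ⟨hn₀, hn₁, ?_⟩
  have hl₀ : HasDerivAt (fun t => log (E₀ t / E₀ t₀) + log (E₀ t₀)) ((E₀ t - P) / E₀ t) t := by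
    have h := ((hd₀ t).div_const (E₀ t₀)).clog ht₀
    have e : (E₀ t - P) / E₀ t₀ / (E₀ t / E₀ t₀) = (E₀ t - P) / E₀ t := by
      field_simp
    rw [e] at h
    exact h.add_const _
  have hl₁ : HasDerivAt (fun t => log (E₁ t / E₁ t₀) + log (E₁ t₀)) ((E₁ t - P) / E₁ t) t := by
    have h := ((hd₁ t).div_const (E₁ t₀)).clog ht₁
    have e : (E₁ t - P) / E₁ t₀ / (E₁ t / E₁ t₀) = (E₁ t - P) / E₁ t := by
      field_simp
    rw [e] at h
    exact h.add_const _
  exact ((hl₀.const_mul (α : ℂ)).add (hl₁.const_mul (1 - (α : ℂ)))).sub (hasDerivAt_id t)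

/-- The derivative in closed form: `Φ'(t) = -P·M(t)/(E₀(t)E₁(t))`, `M = (1-α)E₀ + αE₁`.
[folklore] -/
theorem localPhi_deriv_eq (E₀t E₁t P : ℂ) (α : ℝ) (h₀ : E₀t ≠ 0) (h₁ : E₁t ≠ 0) :
    (α : ℂ) * ((E₀t - P) / E₀t) + (1 - (α : ℂ)) * ((E₁t - P) / E₁t) - 1 =
      -P * ((1 - (α : ℂ)) * E₀t + α * E₁t) / (E₀t * E₁t) := by
  field_simp
  ring

/-- `‖n · 2πi‖ < π` forces the integer `n` to vanish. [folklore] -/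
theorem int_eq_zero_of_norm_mul_two_pi_I_lt {n : ℤ} (h : ‖(n : ℂ) * (2 * Real.pi * I)‖ < Real.pi) :
    n = 0 := by
  have hπ := Real.pi_pos
  rw [norm_mul, Complex.norm_intCast] at h
  have h2 : ‖(2 * Real.pi * I : ℂ)‖ = 2 * Real.pi := by
    rw [norm_mul, norm_mul, Complex.norm_I, mul_one, Complex.norm_real, Complex.norm_two,
      Real.norm_eq_abs, abs_of_pos hπ]
  rw [h2] at h
  have h3 : |(n : ℝ)| < 1 := by nlinarith [abs_nonneg (n : ℝ)]
  have h4 : |n| < 1 := by exact_mod_cast h3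
  exact Int.abs_lt_one_iff.1 h4

/-- **An admissible point**: `E₀, E₁ ≠ 0`, `M = (1-α)E₀ + αE₁ ≠ 0`, `g = 0`. (new) -/
theorem exists_admissible_criticalFibres (a₀ a₁ : ℂ) (ha₀ : a₀ ≠ 0) {α : ℝ} (hα : α ≠ 0) (K : ℂ)
    {P : ℂ} (hP : P ≠ 0) :
    ∃ t : ℂ, P + a₀ * exp (K + t) ≠ 0 ∧ P + a₁ * exp (K + t) ≠ 0 ∧
      (1 - (α : ℂ)) * (P + a₀ * exp (K + t)) + α * (P + a₁ * exp (K + t)) ≠ 0 ∧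
      α * Real.log ‖P + a₀ * exp (K + t)‖ + (1 - α) * Real.log ‖P + a₁ * exp (K + t)‖ - t.re = 0 := by
  obtain ⟨t₀, h₀, h₁, hg⟩ := exists_re_zero_criticalFibres a₀ a₁ ha₀ hα K hP
  by_cases hM : (1 - (α : ℂ)) * (P + a₀ * exp (K + t₀)) + α * (P + a₁ * exp (K + t₀)) ≠ 0
  · exact ⟨t₀, h₀, h₁, hM, hg⟩
  push Not at hM
  set E₀ : ℂ → ℂ := fun t => P + a₀ * exp (K + t) with hE₀
  set E₁ : ℂ → ℂ := fun t => P + a₁ * exp (K + t) with hE₁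
  set b : ℂ := (1 - (α : ℂ)) * a₀ + α * a₁ with hb
  have hMb : ∀ t, (1 - (α : ℂ)) * E₀ t + α * E₁ t = P + b * exp (K + t) := by
    intro t; simp only [hE₀, hE₁, hb]; ring
  have hM' : (1 - (α : ℂ)) * E₀ t₀ + α * E₁ t₀ = 0 := hM
  have hbne : b ≠ 0 := by
    intro hb0
    rw [hMb, hb0, zero_mul, add_zero] at hM'
    exact hP hM'
  -- `M(t) ≠ 0` for `t ≠ t₀` within distance `π`
  have hMne : ∀ t, ‖t - t₀‖ < Real.pi → t ≠ t₀ → (1 - (α : ℂ)) * E₀ t + α * E₁ t ≠ 0 := by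
    intro t ht hne hMt
    rw [hMb] at hMt hM'
    have hexp : exp (K + t) = exp (K + t₀) := by
      have e1 : b * exp (K + t) = -P := by linear_combination hMt
      have e2 : b * exp (K + t₀) = -P := by linear_combination hM'
      exact mul_left_cancel₀ hbne (e1.trans e2.symm)
    obtain ⟨n, hn⟩ := Complex.exp_eq_exp_iff_exists_int.1 hexp
    have htn : t - t₀ = n * (2 * Real.pi * I) := by linear_combination hn
    have hn0 : n = 0 := int_eq_zero_of_norm_mul_two_pi_I_lt (by rw [← htn]; exact ht)
    apply hne
    rw [hn0] at htn
    simpa [sub_eq_zero] using htn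
  -- `Φ`, its derivative near `t₀`, analyticity
  set Φ : ℂ → ℂ := fun t => (α : ℂ) * (log (E₀ t / E₀ t₀) + log (E₀ t₀)) +
    (1 - (α : ℂ)) * (log (E₁ t / E₁ t₀) + log (E₁ t₀)) - t with hΦ
  have hd₀ : ∀ t, HasDerivAt E₀ (E₀ t - P) t := fun t => hasDerivAt_affExp P a₀ K t
  have hd₁ : ∀ t, HasDerivAt E₁ (E₁ t - P) t := fun t => hasDerivAt_affExp P a₁ K t
  have hev := eventually_hasDerivAt_localPhi E₀ E₁ P α hd₀ hd₁ h₀ h₁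
  have han : AnalyticAt ℂ Φ t₀ :=
    Complex.analyticAt_iff_eventually_differentiableAt.2 (hev.mono fun t ht => ht.2.2.differentiableAt)
  -- `Φ` is not locally constant at `t₀`
  have hnc : ¬ (∀ᶠ t in 𝓝 t₀, Φ t = Φ t₀) := by
    intro hc
    have h2 : ∀ᶠ t in 𝓝 t₀, (1 - (α : ℂ)) * E₀ t + α * E₁ t = 0 := by
      filter_upwards [hev, hc.eventually_nhds] with t ht htc
      obtain ⟨hn₀, hn₁, hder⟩ := ht
      have hder0 : HasDerivAt Φ 0 t :=
        (hasDerivAt_const t (Φ t₀)).congr_of_eventuallyEq htc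
      have heq := hder.unique hder0
      rw [localPhi_deriv_eq (E₀ t) (E₁ t) P α hn₀ hn₁] at heq
      rcases div_eq_zero_iff.1 heq with h | h
      · exact (mul_eq_zero.1 h).resolve_left (neg_ne_zero.2 hP)
      · exact absurd h (mul_ne_zero hn₀ hn₁)
    have h3 : ∀ᶠ t in 𝓝[≠] t₀, ((1 - (α : ℂ)) * E₀ t + α * E₁ t = 0 ∧ ‖t - t₀‖ < Real.pi) ∧ t ≠ t₀ := by
      have hballev : ∀ᶠ t in 𝓝 t₀, ‖t - t₀‖ < Real.pi := by
        filter_upwards [Metric.ball_mem_nhds t₀ Real.pi_pos] with t ht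
        simpa [Metric.mem_ball, dist_eq_norm] using ht
      have hA : ∀ᶠ t in 𝓝[≠] t₀, (1 - (α : ℂ)) * E₀ t + α * E₁ t = 0 ∧ ‖t - t₀‖ < Real.pi :=
        (h2.and hballev).filter_mono nhdsWithin_le_nhds
      have hB : ∀ᶠ t in 𝓝[≠] t₀, t ≠ t₀ := by
        filter_upwards [self_mem_nhdsWithin] with t ht
        exact ht
      exact hA.and hB
    obtain ⟨t, ⟨hMt, hball⟩, hne⟩ := h3.exists
    exact hMne t hball hne hMt
  have hle := (han.eventually_constant_or_nhds_le_map_nhds).resolve_left hnc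
  -- a good neighbourhood and its image
  have hU : {t : ℂ | E₀ t ≠ 0 ∧ E₁ t ≠ 0 ∧ ‖t - t₀‖ < Real.pi} ∈ 𝓝 t₀ := by
    have hne₀ : ∀ᶠ t in 𝓝 t₀, E₀ t ≠ 0 := (hd₀ t₀).continuousAt.eventually_ne h₀
    have hne₁ : ∀ᶠ t in 𝓝 t₀, E₁ t ≠ 0 := (hd₁ t₀).continuousAt.eventually_ne h₁
    have hball : ∀ᶠ t in 𝓝 t₀, ‖t - t₀‖ < Real.pi := by
      filter_upwards [Metric.ball_mem_nhds t₀ Real.pi_pos] with t ht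
      simpa [Metric.mem_ball, dist_eq_norm] using ht
    exact (hne₀.and (hne₁.and hball))
  have himg : Φ '' {t : ℂ | E₀ t ≠ 0 ∧ E₁ t ≠ 0 ∧ ‖t - t₀‖ < Real.pi} ∈ 𝓝 (Φ t₀) :=
    hle (image_mem_map hU)
  obtain ⟨ε, hε, hballsub⟩ := Metric.mem_nhds_iff.1 himg
  have hτ : Φ t₀ + ((ε / 2 : ℝ) : ℂ) * I ∈ Metric.ball (Φ t₀) ε := by
    rw [Metric.mem_ball, dist_eq_norm, add_sub_cancel_left, norm_mul, Complex.norm_I, mul_one,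
      Complex.norm_real, Real.norm_eq_abs, abs_of_pos (by positivity)]
    linarith
  obtain ⟨t, ⟨hn₀, hn₁, hdist⟩, hΦt⟩ := hballsub hτ
  have hne : t ≠ t₀ := by
    rintro rfl
    have : ((ε / 2 : ℝ) : ℂ) * I = 0 := by linear_combination hΦt.symm
    have h' : ((ε / 2 : ℝ) : ℂ) = 0 := (mul_eq_zero.1 this).resolve_right Complex.I_ne_zero
    have : (ε / 2 : ℝ) = 0 := by exact_mod_cast h'
    linarith
  refine ⟨t, hn₀, hn₁, hMne t hdist hne, ?_⟩
  have hre_t : (Φ t).re = α * Real.log ‖E₀ t‖ + (1 - α) * Real.log ‖E₁ t‖ - t.re :=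
    re_localPhi E₀ E₁ α h₀ h₁ hn₀ hn₁
  have hre_0 : (Φ t₀).re = α * Real.log ‖E₀ t₀‖ + (1 - α) * Real.log ‖E₁ t₀‖ - t₀.re :=
    re_localPhi E₀ E₁ α h₀ h₁ h₀ h₁
  have hg' : α * Real.log ‖E₀ t₀‖ + (1 - α) * Real.log ‖E₁ t₀‖ - t₀.re = 0 := hg
  change α * Real.log ‖E₀ t‖ + (1 - α) * Real.log ‖E₁ t‖ - t.re = 0
  rw [← hre_t, hΦt, Complex.add_re, hre_0, hg']
  simp

/-- **The local inverse of `Φ` at a non-degenerate point of the domain.** [folklore] -/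
theorem criticalFibres_localInverse (a₀ a₁ : ℂ) (α : ℝ) (K : ℂ) {P : ℂ} (hP : P ≠ 0) {t₀ : ℂ}
    (h₀ : P + a₀ * exp (K + t₀) ≠ 0) (h₁ : P + a₁ * exp (K + t₀) ≠ 0)
    (hM : (1 - (α : ℂ)) * (P + a₀ * exp (K + t₀)) + α * (P + a₁ * exp (K + t₀)) ≠ 0) :
    ∃ ψ : ℂ → ℂ,
      Tendsto ψ (𝓝 ((fun t : ℂ => (α : ℂ) * (log ((P + a₀ * exp (K + t)) / (P + a₀ * exp (K + t₀))) +
          log (P + a₀ * exp (K + t₀))) + (1 - (α : ℂ)) * (log ((P + a₁ * exp (K + t)) /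
          (P + a₁ * exp (K + t₀))) + log (P + a₁ * exp (K + t₀))) - t) t₀)) (𝓝 t₀) ∧
      ∀ᶠ τ in 𝓝 ((fun t : ℂ => (α : ℂ) * (log ((P + a₀ * exp (K + t)) / (P + a₀ * exp (K + t₀))) +
          log (P + a₀ * exp (K + t₀))) + (1 - (α : ℂ)) * (log ((P + a₁ * exp (K + t)) /
          (P + a₁ * exp (K + t₀))) + log (P + a₁ * exp (K + t₀))) - t) t₀),
        (fun t : ℂ => (α : ℂ) * (log ((P + a₀ * exp (K + t)) / (P + a₀ * exp (K + t₀))) +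
          log (P + a₀ * exp (K + t₀))) + (1 - (α : ℂ)) * (log ((P + a₁ * exp (K + t)) /
          (P + a₁ * exp (K + t₀))) + log (P + a₁ * exp (K + t₀))) - t) (ψ τ) = τ := by
  set E₀ : ℂ → ℂ := fun t => P + a₀ * exp (K + t) with hE₀
  set E₁ : ℂ → ℂ := fun t => P + a₁ * exp (K + t) with hE₁
  set Φ : ℂ → ℂ := fun t => (α : ℂ) * (log (E₀ t / E₀ t₀) + log (E₀ t₀)) +
    (1 - (α : ℂ)) * (log (E₁ t / E₁ t₀) + log (E₁ t₀)) - t with hΦ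
  have hd₀ : ∀ t, HasDerivAt E₀ (E₀ t - P) t := fun t => hasDerivAt_affExp P a₀ K t
  have hd₁ : ∀ t, HasDerivAt E₁ (E₁ t - P) t := fun t => hasDerivAt_affExp P a₁ K t
  have hev := eventually_hasDerivAt_localPhi E₀ E₁ P α hd₀ hd₁ h₀ h₁
  have han : AnalyticAt ℂ Φ t₀ :=
    Complex.analyticAt_iff_eventually_differentiableAt.2 (hev.mono fun t ht => ht.2.2.differentiableAt)
  obtain ⟨-, -, hder⟩ := hev.self_of_nhds
  set φ' : ℂ := (α : ℂ) * ((E₀ t₀ - P) / E₀ t₀) + (1 - (α : ℂ)) * ((E₁ t₀ - P) / E₁ t₀) - 1 with hφ'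
  have hφne : φ' ≠ 0 := by
    rw [hφ', localPhi_deriv_eq (E₀ t₀) (E₁ t₀) P α h₀ h₁]
    exact div_ne_zero (mul_ne_zero (neg_ne_zero.2 hP) hM) (mul_ne_zero h₀ h₁)
  have hstrict : HasStrictDerivAt Φ φ' t₀ := by
    have h := han.contDiffAt.hasStrictDerivAt (n := 1) one_ne_zero
    rwa [hder.deriv] at h
  refine ⟨hstrict.localInverse Φ φ' t₀ hφne,
    (hstrict.hasStrictFDerivAt_equiv hφne).localInverse_tendsto,
    hstrict.eventually_right_inverse hφne⟩

/-- `-2πi·θ` with `θ = -Im Φ₀/(2π)` is `Φ₀` when `Re Φ₀ = 0`. [folklore] -/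
theorem neg_two_pi_I_mul_eq_of_re_eq_zero {Φ₀ : ℂ} (h : Φ₀.re = 0) :
    -(2 * Real.pi * I) * (((-Φ₀.im / (2 * Real.pi) : ℝ)) : ℂ) = Φ₀ := by
  have hπ : (Real.pi : ℂ) ≠ 0 := by exact_mod_cast Real.pi_pos.ne'
  have e1 : -(2 * Real.pi * I) * (((-Φ₀.im / (2 * Real.pi) : ℝ)) : ℂ) = (Φ₀.im : ℂ) * I := by
    push_cast
    field_simp
  rw [e1]
  apply Complex.ext
  · simp [h]
  · simp

end Local

end Summit.Schanuel.Schanuel.Theorems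

end
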